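import Mathlib
import HarnessLib

/-!
# `NoHeavyLowerTail` (crux stmt-CriticalPhenomena-4575), antithetic vdBHK programme: UNCROSSING IDENTITIES for the rearrangement functional (R) —
# a T-pattern pair splits into a NESTED and an ANTI-NESTED modification at the cost of two AK slacks

Support file (seat `prim-ineq-gen-7` gen 53; `--supports stmt-CriticalPhenomena-4575`).  No `sorry`, no definitions.  Memo: FINDING-UNCROSS-g53.md §2b.

SETTING (as in `AntitheticWedgeTransfer`, `AntitheticWedgeNesting`).  For T-pattern quadruples `𝐀 = (A₁,A₂,A₃,A₄)`, `𝐁` of up-sets of `X` (sheets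
`RB, RR, BB, BR` of `T(X;L)`) the (R)-functional is `R(𝐀,𝐁) = #(A₂∩B₂) + #(A₃∩B₃) + #((A₄∖A₁)∩(B₄∖B₁)) − #(A₂∩ιB₃) − #(A₃∩ιB₂)`; it is MODULAR in the
up-set `𝐀` of `T(X;L)`.  Joining / meeting `𝐀` with the constant quadruple `𝐂₃ = (A₃,A₃,A₃,A₃)` gives
`𝐀 ∨ 𝐂₃ = (A₃, A₂∪A₃, A₃, A₄∪A₃)` (inner pair NESTED: `A₃ ⊆ A₂∪A₃`) and `𝐀 ∧ 𝐂₃ = (A₁, A₂∩A₃, A₃, A₄∩A₃)` (inner pair ANTI-NESTED), and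
`R(𝐂₃,𝐁) = AKsl(A₃,B₂) + AKsl(A₃,B₃)` (`AKsl(a,b) = #(a∩b) − #(a∩ιb)`, no relays).
* `AntitheticWedgeUncross.R_split_at_BB` — the identity `R(𝐀∨𝐂₃,𝐁) + R(𝐀∧𝐂₃,𝐁) = R(𝐀,𝐁) + AKsl(A₃,B₂) + AKsl(A₃,B₃)` (for `A₁ ⊆ A₃`), stated in `ℕ`
  without subtraction.  Consequence (memo §2b): if `R(𝐀,𝐁) < −(AKsl(A₃,B₂)+AKsl(A₃,B₃))` then a comparable (nested or anti-nested) modification of `𝐀`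
  violates (R) against the same `𝐁` — one of the reductions behind 'CONJECTURE C′ ⟺ CONJECTURE U' and the balanced-two-component obstruction.
* `AntitheticWedgeUncross.join_BB_tpattern`, `meet_BB_tpattern` — both modifications are again T-pattern quadruples (so (R) applies to them).
The symmetric statements with `𝐂₂ = (A₂,A₂,A₂,A₂)` (modifications `(A₁∪A₂, A₂, A₂∪A₃, A₄∪A₂)`, `(A₁∩A₂, A₂, A₂∩A₃, A₄∩A₂)`) are identical in shape.
-/

namespace Summit.CriticalPhenomena.PercolationContinuityZ3.Theorems

open Finset

namespace AntitheticWedgeUncross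

variable {X : Type*} [DecidableEq X]

/-- **Uncrossing identity at the BB sheet.**  For `A₁ ⊆ A₃` and any `ι, A₂, A₄, B₁, …, B₄`:
`R((A₃, A₂∪A₃, A₃, A₄∪A₃), 𝐁) + R((A₁, A₂∩A₃, A₃, A₄∩A₃), 𝐁) = R(𝐀,𝐁) + [#(A₃∩B₂) + #(A₃∩B₃) − #(A₃∩ιB₃) − #(A₃∩ιB₂)]`, written additively. [this work] -/
theorem R_split_at_BB (ι : X → X) (A₁ A₂ A₃ A₄ B₁ B₂ B₃ B₄ : Finset X) (h13 : A₁ ⊆ A₃) :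
    (((A₂ ∪ A₃) ∩ B₂).card + (A₃ ∩ B₃).card + (((A₄ ∪ A₃) \ A₃) ∩ (B₄ \ B₁)).card) +
      (((A₂ ∩ A₃) ∩ B₂).card + (A₃ ∩ B₃).card + (((A₄ ∩ A₃) \ A₁) ∩ (B₄ \ B₁)).card) +
      ((A₂ ∩ B₃.image ι).card + (A₃ ∩ B₂.image ι).card) + ((A₃ ∩ B₃.image ι).card + (A₃ ∩ B₂.image ι).card) =
    ((A₂ ∩ B₂).card + (A₃ ∩ B₃).card + ((A₄ \ A₁) ∩ (B₄ \ B₁)).card) + ((A₃ ∩ B₂).card + (A₃ ∩ B₃).card) +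
      (((A₂ ∪ A₃) ∩ B₃.image ι).card + (A₃ ∩ B₂.image ι).card) + (((A₂ ∩ A₃) ∩ B₃.image ι).card + (A₃ ∩ B₂.image ι).card) := by
  classical
  -- modularity of S ↦ #(S ∩ T) on the pair A₂, A₃
  have mod : ∀ T : Finset X, ((A₂ ∪ A₃) ∩ T).card + ((A₂ ∩ A₃) ∩ T).card = (A₂ ∩ T).card + (A₃ ∩ T).card := by
    intro T
    have hu : (A₂ ∩ T) ∪ (A₃ ∩ T) = (A₂ ∪ A₃) ∩ T := by
      ext x; simp only [Finset.mem_union, Finset.mem_inter]; tauto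
    have hi : (A₂ ∩ T) ∩ (A₃ ∩ T) = (A₂ ∩ A₃) ∩ T := by
      ext x; simp only [Finset.mem_inter]; tauto
    have := Finset.card_union_add_card_inter (A₂ ∩ T) (A₃ ∩ T)
    rw [hu, hi] at this
    exact this
  have m1 := mod B₂
  have m2 := mod (B₃.image ι)
  -- the relay set splits: A₄ ∖ A₁ = (A₄ ∖ A₃) ⊔ ((A₄ ∩ A₃) ∖ A₁)
  have r1 : ((A₄ ∪ A₃) \ A₃) ∩ (B₄ \ B₁) = (A₄ \ A₃) ∩ (B₄ \ B₁) := by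
    ext x; simp only [Finset.mem_inter, Finset.mem_sdiff, Finset.mem_union]; tauto
  have rdisj : Disjoint ((A₄ \ A₃) ∩ (B₄ \ B₁)) (((A₄ ∩ A₃) \ A₁) ∩ (B₄ \ B₁)) := by
    rw [Finset.disjoint_left]
    intro x hx hx'
    simp only [Finset.mem_inter, Finset.mem_sdiff] at hx hx'
    exact hx.1.2 hx'.1.1.2
  have runion : ((A₄ \ A₃) ∩ (B₄ \ B₁)) ∪ (((A₄ ∩ A₃) \ A₁) ∩ (B₄ \ B₁)) = (A₄ \ A₁) ∩ (B₄ \ B₁) := by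
    ext x; simp only [Finset.mem_union, Finset.mem_inter, Finset.mem_sdiff]
    constructor
    · rintro (⟨⟨h4, h3⟩, hB⟩ | ⟨⟨⟨h4, _⟩, h1⟩, hB⟩)
      · exact ⟨⟨h4, fun h1 => h3 (h13 h1)⟩, hB⟩
      · exact ⟨⟨h4, h1⟩, hB⟩
    · rintro ⟨⟨h4, h1⟩, hB⟩
      by_cases h3 : x ∈ A₃
      · exact Or.inr ⟨⟨⟨h4, h3⟩, h1⟩, hB⟩
      · exact Or.inl ⟨⟨h4, h3⟩, hB⟩
  have r2 : ((A₄ \ A₃) ∩ (B₄ \ B₁)).card + (((A₄ ∩ A₃) \ A₁) ∩ (B₄ \ B₁)).card = ((A₄ \ A₁) ∩ (B₄ \ B₁)).card := by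
    rw [← Finset.card_union_of_disjoint rdisj, runion]
  rw [r1]
  omega

/-- The nested modification `(A₃, A₂∪A₃, A₃, A₄∪A₃)` of a T-pattern is a T-pattern (up-set-ness of unions being standard, we list the six pattern
conditions; `C(A₂,A₃)` and the up-closedness of `A₃` are what is used). [this work] -/
theorem join_BB_tpattern [PartialOrder X] (L : Finset X) (A₂ A₃ A₄ : Finset X)
    (hA₃ : ∀ x y, x ≤ y → x ∈ A₃ → y ∈ A₃) (a24 : A₂ ⊆ A₄)
    (aC34 : ∀ x y, x ≤ y → x ∈ L → y ∉ L → x ∈ A₃ → y ∈ A₄) (aC23 : ∀ x y, x ≤ y → x ∈ L → y ∉ L → x ∈ A₂ → y ∈ A₃) :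
    A₃ ⊆ A₃ ∧ (A₂ ∪ A₃) ⊆ (A₄ ∪ A₃) ∧ (∀ x, x ∈ L → x ∈ A₃ → x ∈ A₄ ∪ A₃) ∧ (∀ x, x ∉ L → x ∈ A₃ → x ∈ A₂ ∪ A₃) ∧
      (∀ x y, x ≤ y → x ∈ L → y ∉ L → x ∈ A₃ → y ∈ A₄ ∪ A₃) ∧ (∀ x y, x ≤ y → x ∈ L → y ∉ L → x ∈ A₂ ∪ A₃ → y ∈ A₃) := by
  refine ⟨Finset.Subset.refl _, ?_, ?_, ?_, ?_, ?_⟩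
  · intro x hx; rw [Finset.mem_union] at hx ⊢
    rcases hx with hx | hx
    · exact Or.inl (a24 hx)
    · exact Or.inr hx
  · intro x _ hx; exact Finset.mem_union.2 (Or.inr hx)
  · intro x _ hx; exact Finset.mem_union.2 (Or.inr hx)
  · intro x y hxy hxL hyL hx; exact Finset.mem_union.2 (Or.inl (aC34 x y hxy hxL hyL hx))
  · intro x y hxy hxL hyL hx
    rcases Finset.mem_union.1 hx with hx | hx
    · exact aC23 x y hxy hxL hyL hx
    · exact hA₃ x y hxy hx

/-- The anti-nested modification `(A₁, A₂∩A₃, A₃, A₄∩A₃)` of a T-pattern is a T-pattern. [this work] -/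
theorem meet_BB_tpattern [PartialOrder X] (L : Finset X) (A₁ A₂ A₃ A₄ : Finset X)
    (hA₃ : ∀ x y, x ≤ y → x ∈ A₃ → y ∈ A₃) (a13 : A₁ ⊆ A₃) (a24 : A₂ ⊆ A₄)
    (a34 : ∀ x, x ∈ L → x ∈ A₃ → x ∈ A₄) (a12 : ∀ x, x ∉ L → x ∈ A₁ → x ∈ A₂)
    (aC34 : ∀ x y, x ≤ y → x ∈ L → y ∉ L → x ∈ A₃ → y ∈ A₄) :
    A₁ ⊆ A₃ ∧ (A₂ ∩ A₃) ⊆ (A₄ ∩ A₃) ∧ (∀ x, x ∈ L → x ∈ A₃ → x ∈ A₄ ∩ A₃) ∧ (∀ x, x ∉ L → x ∈ A₁ → x ∈ A₂ ∩ A₃) ∧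
      (∀ x y, x ≤ y → x ∈ L → y ∉ L → x ∈ A₃ → y ∈ A₄ ∩ A₃) ∧ (∀ x y, x ≤ y → x ∈ L → y ∉ L → x ∈ A₂ ∩ A₃ → y ∈ A₃) := by
  refine ⟨a13, ?_, ?_, ?_, ?_, ?_⟩
  · intro x hx; rw [Finset.mem_inter] at hx ⊢; exact ⟨a24 hx.1, hx.2⟩
  · intro x hxL hx; exact Finset.mem_inter.2 ⟨a34 x hxL hx, hx⟩
  · intro x hxL hx; exact Finset.mem_inter.2 ⟨a12 x hxL hx, a13 hx⟩
  · intro x y hxy hxL hyL hx; exact Finset.mem_inter.2 ⟨aC34 x y hxy hxL hyL hx, hA₃ x y hxy hx⟩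
  · intro x y hxy _ _ hx; exact hA₃ x y hxy (Finset.mem_inter.1 hx).2

end AntitheticWedgeUncross

end Summit.CriticalPhenomena.PercolationContinuityZ3.Theorems
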